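import Literature.AlgebraicGeometry.AbelianSchemes.AbelianSchemeIsLambdaOfAtConjugate
import Literature.AlgebraicGeometry.AbelianSchemes.PolarizedAbelianSchemeWithLevelBaseChange
import HarnessLib

/-!
# Transport of Mumford's `λ̄ = Λ(𝒪(Θ))` between fibres: the engine behind the `σ`-twist, witness re-bracketing, and
# the point-equality step ([MFK94] Ch. 6 §2 Def. 6.2–6.3; Milne §14 «`σ(A, s, ηK) = (σA, σs, σηK)`»)

Layer `Literature/AlgebraicGeometry/AbelianSchemes`, namespace `Literature.AlgebraicGeometry.AbelianSchemes.AbelianSchemeOver`.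
KERNEL ONLY: theorems; no definition, no named fact, no instance, no `sorry`.  Cell `hodgecm-mathlib`, M1PRIME-DAG rung 0,
W3 § 7d (`h1R`, the `hpair` conjunct of `DBCSigmaExportR`) and K3 (c-ii-T): the THEOREMS-ONLY SEQUEL of ★
`AbelianSchemeIsLambdaOfAtConjugate` (B-p11; router word R18), carrying three generic complements:

* §E1 **`IsLambdaOfAt.transport`** — the engine of which ★ `IsLambdaOfAt.along_specTwist` is the instance `φ = ψ`: for two
  field-valued points `s₁ : Spec L₁ → S`, `s₂ : Spec L₂ → S` of the base of an abelian scheme `A/S` with dual pair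
  `D = (Â, 𝒫)` and `S`-morphism `λ : A → Â`, ANY dominant morphism of underlying schemes `φ : A_{s₂} → A_{s₁}` commuting
  with the projections to `A` (`φ ≫ pr_A = pr_A`), reading a map of points `π₀ : A_{s₂}(L₂) → A_{s₁}(L₁)`
  (`φ ≫ pr ≫ x(π₀ P') = pr ≫ x(P')`) and intertwining the translations (`t_{P'} ≫ φ = φ ≫ t_{π₀ P'}`) carries
  [MumfordFogartyKirwan1994, Def. 6.2] «`Λ(L)(x) = T_x^*L ⊗ L⁻¹`» (the tree's `IsLambdaOfAt`) from `s₁` to `s₂`: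
  `λ̄ = Λ(𝒪(Θ))` at `s₁` ⟹ `λ̄ = Λ(𝒪(φ^*Θ))` at `s₂`.  Proof: the slice of `A_{s₂}` at `λ̄(P')` IS `φ` followed by the slice
  of `A_{s₁}` at `λ̄(π₀ P')` (`sliceAt_eq_comp_sliceAt_of_transport`), so both sides of Mumford's identity are rank-one
  modules on the integral fibre `A_{s₂}` with the same class `φ^*(t_{π₀P'}^*[Θ]·[Θ]⁻¹) = t_{P'}^*[φ^*Θ]·[φ^*Θ]⁻¹` in
  `Ȟ¹(A_{s₂}, 𝒪^×)` (★ `detClass_translationPullback_tensor_dual`, ★ `cechClass_pullback`), hence isomorphic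
  (★ `nonempty_iso_iff_detClass_eq`, [Hartshorne1977, III Ex. 4.5]).  Nothing ties `L₁` to `L₂`; `φ` need not be linear;
* §E2 **`IsLambdaOfAt.of_sameDivisor`** — `IsLambdaOfAt` depends on the witness only through `[Θ] ∈ Ȟ¹(A_s, 𝒪^×)`
  (re-bracketing `g'^*(g^*Θ) ∼ (g' ≫ g)^*Θ`, `(𝟙)^*Θ ∼ Θ`), and **`IsLambdaOfAt.along_specTwist_pullback_pullback`** =
  ★ `along_specTwist` with the divisor LITERALLY the tree's conjugate divisor `Θ^σ = π_σ^*Θ` (★ `weilPairingLevel_conjugate`,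
  same `(π, hπ)` typing) carried to `A_{Spec σ ≫ s}` along `e⁻¹`, `e = conjFibreIso σ s`;
* §E3 **`IsLambdaOfAt.along_fibreCongrIso{,_symm}`** — the POINT-EQUALITY step along ★ `fibreCongrIso (h : s₁ = s₂)`
  (`PolarizedAbelianSchemeWithLevelBaseChange` §4, the `eqToIso` bookkeeping for `𝟙 ≫ Spec σ = Spec σ ≫ 𝟙`), so that the
  `σ`-twist (point `Spec σ ≫ s`) composes with ★ `IsLambdaOfAt.baseChange` (point `t ≫ g`) without a `▸`.

USE (cell): § 7d step (3) of the W3 assembly = ★ `along_specTwist_pullback_pullback` at `s = 𝟙 (Spec ℂ)` →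
`along_fibreCongrIso_symm` to the point `𝟙 ≫ Spec σ` → ★ `IsLambdaOfAt.baseChange` at `t = 𝟙` → `of_sameDivisor` to the
witness `jσ^*(Θ₁^σ)` of the re-base `Pσ`.  HC_CM is proved only modulo the 7 printed citations until rung 0 closes; this
file discharges none of them.

## References
* [MumfordFogartyKirwan1994] D. Mumford, J. Fogarty, F. Kirwan, *Geometric Invariant Theory*, 3rd ed. (1994), Ch. 6 §2
  Def. 6.2–6.3 (p. 120), Ch. 7 §2 Def. 7.2 (p. 129).
* [Milne2005ShimuraVarieties] J. S. Milne, *Introduction to Shimura varieties* (2005/2017), §11 p. 108, §14 pp. 124–125.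
* [GortzWedhorn2020] U. Görtz, T. Wedhorn, *Algebraic Geometry I*, 2nd ed. (2020), Section (4.7) (p. 135), Prop. 4.16,
  Def. 11.49 (p. 392).
* [Hartshorne1977] R. Hartshorne, *Algebraic Geometry* (1977), II Ex. 6.8, III Ex. 4.5.
-/

universe u

open CategoryTheory CategoryTheory.Limits AlgebraicGeometry MonoidalCategory

noncomputable section

namespace Literature.AlgebraicGeometry.Modules

open Literature.AlgebraicGeometry.Motives

variable {X Y Z : Scheme.{u}}

/-- `f^*(g^*γ) = (f ≫ g)^*γ` on `Ȟ¹(·, 𝒪^×)` (★ `CechPic.pullback_comp` read right to left; re-derived privately from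
`detClass_pullback` and `(f ≫ g)^*E ≅ f^*g^*E`, as in the two ★ parents, to stay inside their import cone).
[cite: Hartshorne1977, II Ex. 6.8 (a)] -/
private theorem cechPic_pullback_comp_symm' (f : X ⟶ Y) (g : Y ⟶ Z) (γ : CechPic Z) :
    CechPic.pullback f (CechPic.pullback g γ) = CechPic.pullback (f ≫ g) γ := by
  obtain ⟨c, rfl⟩ := CechPic.mk_surjective γ
  have hE := c.isFiniteLocallyFree_lineBundle
  rw [← c.detClass_lineBundle, ← detClass_pullback, ← detClass_pullback, ← detClass_pullback]
  exact (detClass_eq_of_iso ((Scheme.Modules.pullbackComp f g).app (lineBundle c)).symm _ _).symm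

end Literature.AlgebraicGeometry.Modules

namespace Literature.AlgebraicGeometry.AbelianSchemes

open Literature.AlgebraicGeometry.Motives Literature.AlgebraicGeometry.AbelianVarieties
  Literature.AlgebraicGeometry.Modules
open scoped MonObj CategoryTheory.Obj

namespace AbelianSchemeOver

variable {S : Scheme.{u}} (A : AbelianSchemeOver S) (D : A.DualPair) (lam : A.X ⟶ D.hat.X)
  {L : Type u} [Field L] (σ : L ≃+* L) (s : Spec (.of L) ⟶ S)

/-! ### §E1 The transport engine: `IsLambdaOfAt` along a projection-compatible, translation-equivariant morphism of fibres -/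

section Transport

variable {L₁ L₂ : Type u} [Field L₁] [Field L₂] {s₁ : Spec (.of L₁) ⟶ S} {s₂ : Spec (.of L₂) ⟶ S}
  (φ : ((A.fibre s₂).toAbelianVariety).X.left ⟶ ((A.fibre s₁).toAbelianVariety).X.left)
  (π₀ : (A.fibre s₂).toAbelianVariety.Points L₂ → (A.fibre s₁).toAbelianVariety.Points L₁)
  (ha : φ ≫ pullback.fst A.X.hom s₁ = pullback.fst A.X.hom s₂)
  (hb : ∀ P' : (A.fibre s₂).toAbelianVariety.Points L₂,
    φ ≫ pullback.snd A.X.hom s₁ ≫ A.fibrePointToLeft s₁ (π₀ P') = pullback.snd A.X.hom s₂ ≫ A.fibrePointToLeft s₂ P')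

include ha hb in
/-- **The slice of `A_{s₂}` at `λ̄(P')` is `φ` followed by the slice of `A_{s₁}` at `λ̄(π₀ P')`** whenever `φ : A_{s₂} → A_{s₁}`
commutes with the projections to `A` and reads `π₀` on points (`a ↦ (a, λ̄(P'))` vs `a ↦ (φ a, λ̄(π₀ P'))`: both components
agree in `A ×_S Â`). [cite: MumfordFogartyKirwan1994, Ch. 6 §2 Definition 6.2 (p. 120)] -/
theorem sliceAt_eq_comp_sliceAt_of_transport (P' : (A.fibre s₂).toAbelianVariety.Points L₂) :
    A.sliceAt s₂ D lam P' = φ ≫ A.sliceAt s₁ D lam (π₀ P') := by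
  apply pullback.hom_ext
  · calc A.sliceAt s₂ D lam P' ≫ pullback.fst A.X.hom D.hat.X.hom
        = pullback.fst A.X.hom s₂ := A.sliceAt_fst s₂ D lam P'
      _ = φ ≫ pullback.fst A.X.hom s₁ := ha.symm
      _ = φ ≫ A.sliceAt s₁ D lam (π₀ P') ≫ pullback.fst A.X.hom D.hat.X.hom :=
          whisker_eq φ (A.sliceAt_fst s₁ D lam (π₀ P')).symm
      _ = (φ ≫ A.sliceAt s₁ D lam (π₀ P')) ≫ pullback.fst A.X.hom D.hat.X.hom := (Category.assoc _ _ _).symm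
  · calc A.sliceAt s₂ D lam P' ≫ pullback.snd A.X.hom D.hat.X.hom
        = pullback.snd A.X.hom s₂ ≫ A.valueAt s₂ D lam P' := A.sliceAt_snd s₂ D lam P'
      _ = (pullback.snd A.X.hom s₂ ≫ A.fibrePointToLeft s₂ P') ≫ lam.left := (Category.assoc _ _ _).symm
      _ = (φ ≫ pullback.snd A.X.hom s₁ ≫ A.fibrePointToLeft s₁ (π₀ P')) ≫ lam.left := eq_whisker (hb P').symm _
      _ = φ ≫ (pullback.snd A.X.hom s₁ ≫ A.fibrePointToLeft s₁ (π₀ P')) ≫ lam.left := Category.assoc _ _ _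
      _ = φ ≫ pullback.snd A.X.hom s₁ ≫ A.valueAt s₁ D lam (π₀ P') := whisker_eq φ (Category.assoc _ _ _)
      _ = φ ≫ A.sliceAt s₁ D lam (π₀ P') ≫ pullback.snd A.X.hom D.hat.X.hom :=
          whisker_eq φ (A.sliceAt_snd s₁ D lam (π₀ P')).symm
      _ = (φ ≫ A.sliceAt s₁ D lam (π₀ P')) ≫ pullback.snd A.X.hom D.hat.X.hom := (Category.assoc _ _ _).symm

variable [IsDominant φ]
  (hc : ∀ P' : (A.fibre s₂).toAbelianVariety.Points L₂,
    ((A.fibre s₂).toAbelianVariety.translation P').left ≫ φ =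
      φ ≫ ((A.fibre s₁).toAbelianVariety.translation (π₀ P')).left)

include ha hb hc in
/-- **Transport of `λ̄ = Λ(𝒪(Θ))` along `φ`** ([MumfordFogartyKirwan1994, Def. 6.2–6.3] at two field-valued points of `S`;
the engine of which `IsLambdaOfAt.along_specTwist` is the instance `φ = ψ`): if `φ : A_{s₂} → A_{s₁}` is a dominant
morphism of underlying schemes commuting with the projections to `A`, reading a map of points `π₀` and intertwining the
translations (`t_{P'} ≫ φ = φ ≫ t_{π₀ P'}`), then `λ̄ = Λ(𝒪(Θ))` at `s₁` implies `λ̄ = Λ(𝒪(φ^*Θ))` at `s₂`.  Both sides of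
Mumford's identity at `P'` are rank-one modules on the integral fibre `A_{s₂}` with class
`φ^*(t_{π₀P'}^*[Θ]·[Θ]⁻¹) = t_{P'}^*[φ^*Θ]·[φ^*Θ]⁻¹` (slice square, ★ `detClass_translationPullback_tensor_dual`,
`[φ^*Θ] = φ^*[Θ]`), hence isomorphic (`Pic ↪ Ȟ¹`).  No hypothesis ties `L₁` to `L₂` or asks `φ` to be linear.
[cite: MumfordFogartyKirwan1994, Ch. 6 §2 Definition 6.2–6.3 (p. 120)] [cite: Hartshorne1977, III Ex. 4.5] -/
theorem IsLambdaOfAt.transport (Θ : CartierDivisor (A.fibre s₁).toAbelianVariety.X.left)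
    (h : A.IsLambdaOfAt s₁ D lam Θ) : A.IsLambdaOfAt s₂ D lam (Θ.pullback φ) := by
  intro P'
  obtain ⟨i⟩ := h (π₀ P')
  have hl' : HasRank ((Scheme.Modules.pullback (A.sliceAt s₂ D lam P')).obj D.P) 1 := hasRank_pullback _ D.hasRank_one
  have hl : HasRank ((Scheme.Modules.pullback (A.sliceAt s₁ D lam (π₀ P'))).obj D.P) 1 := hasRank_pullback _ D.hasRank_one
  have hr' : HasRank (tensorObj
      ((Scheme.Modules.pullback ((A.fibre s₂).toAbelianVariety.translation P').left).obj
        (A.lineBundleOfDivisor s₂ (Θ.pullback φ)))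
      (Modules.dual (A.lineBundleOfDivisor s₂ (Θ.pullback φ)))) 1 :=
    hasRank_tensorObj_one (hasRank_pullback _ (A.hasRank_lineBundleOfDivisor s₂ _))
      (hasRank_dual (A.hasRank_lineBundleOfDivisor s₂ _))
  have hr : HasRank (tensorObj
      ((Scheme.Modules.pullback ((A.fibre s₁).toAbelianVariety.translation (π₀ P')).left).obj
        (A.lineBundleOfDivisor s₁ Θ))
      (Modules.dual (A.lineBundleOfDivisor s₁ Θ))) 1 :=
    hasRank_tensorObj_one (hasRank_pullback _ (A.hasRank_lineBundleOfDivisor s₁ _))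
      (hasRank_dual (A.hasRank_lineBundleOfDivisor s₁ _))
  refine (nonempty_iso_iff_detClass_eq hl' hr' (HasRank.isFiniteLocallyFree' hl')
    (HasRank.isFiniteLocallyFree' hr')).2 ?_
  -- the slice square, as an isomorphism of modules `slice'^*𝒫 ≅ φ^*(slice^*𝒫)`
  have j : (Scheme.Modules.pullback (A.sliceAt s₂ D lam P')).obj D.P ≅
      (Scheme.Modules.pullback φ).obj ((Scheme.Modules.pullback (A.sliceAt s₁ D lam (π₀ P'))).obj D.P) :=
    (Scheme.Modules.pullbackCongr (A.sliceAt_eq_comp_sliceAt_of_transport D lam φ π₀ ha hb P')).app D.P ≪≫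
      ((Scheme.Modules.pullbackComp φ (A.sliceAt s₁ D lam (π₀ P'))).app D.P).symm
  have lhs_eq : detClass (HasRank.isFiniteLocallyFree' hl') =
      CechPic.pullback φ (CechPic.pullback ((A.fibre s₁).toAbelianVariety.translation (π₀ P')).left Θ.cechClass *
        (Θ.cechClass)⁻¹) :=
    (detClass_eq_of_iso j _ ((HasRank.isFiniteLocallyFree' hl).pullback φ)).trans
      ((detClass_pullback φ (HasRank.isFiniteLocallyFree' hl)).trans
        (congrArg (CechPic.pullback φ)
          ((detClass_eq_of_iso i _ (HasRank.isFiniteLocallyFree' hr)).trans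
            (A.detClass_translationPullback_tensor_dual s₁ Θ (π₀ P') _))))
  have mid : CechPic.pullback φ
        (CechPic.pullback ((A.fibre s₁).toAbelianVariety.translation (π₀ P')).left Θ.cechClass * (Θ.cechClass)⁻¹) =
      CechPic.pullback ((A.fibre s₂).toAbelianVariety.translation P').left (CechPic.pullback φ Θ.cechClass) *
        (CechPic.pullback φ Θ.cechClass)⁻¹ := by
    rw [map_mul, map_inv, cechPic_pullback_comp_symm', cechPic_pullback_comp_symm', hc P']
  have rhs_eq : detClass (HasRank.isFiniteLocallyFree' hr') =
      CechPic.pullback ((A.fibre s₂).toAbelianVariety.translation P').left (CechPic.pullback φ Θ.cechClass) *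
        (CechPic.pullback φ Θ.cechClass)⁻¹ := by
    rw [A.detClass_translationPullback_tensor_dual s₂ (Θ.pullback φ) P' (HasRank.isFiniteLocallyFree' hr'),
      CartierDivisor.cechClass_pullback]
  exact lhs_eq.trans (mid.trans rhs_eq.symm)

end Transport

/-! ### §E2 `IsLambdaOfAt` depends on the witness divisor only through its class in `Ȟ¹` -/

section SameDivisor

/-- **Mumford's `T_x^*L ⊗ L⁻¹` for `L = 𝒪(Θ)` depends on `Θ` only through `[Θ] ∈ Ȟ¹(A_s, 𝒪^×)`**: if `Θ` and `Θ'` are the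
same divisor (chartwise `fᵢ/f'ⱼ` units, the tree's `SameDivisor`; in particular `[Θ] = [Θ']`), then
`t_P^*𝒪(Θ) ⊗ 𝒪(Θ)⁻¹ ≅ t_P^*𝒪(Θ') ⊗ 𝒪(Θ')⁻¹` (rank one, equal classes `t_P^*[Θ]·[Θ]⁻¹`).
[cite: MumfordFogartyKirwan1994, Ch. 6 §2 Definition 6.2 (p. 120)] [cite: Hartshorne1977, III Ex. 4.5] -/
theorem nonempty_translationPullback_tensor_dual_iso_of_sameDivisor
    {Θ Θ' : CartierDivisor (A.fibre s).toAbelianVariety.X.left} (hΘ : Θ.SameDivisor Θ')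
    (P : (A.fibre s).toAbelianVariety.Points L) :
    Nonempty (tensorObj
        ((Scheme.Modules.pullback ((A.fibre s).toAbelianVariety.translation P).left).obj (A.lineBundleOfDivisor s Θ))
        (Modules.dual (A.lineBundleOfDivisor s Θ)) ≅
      tensorObj
        ((Scheme.Modules.pullback ((A.fibre s).toAbelianVariety.translation P).left).obj (A.lineBundleOfDivisor s Θ'))
        (Modules.dual (A.lineBundleOfDivisor s Θ'))) := by
  have hr : ∀ Θ₀ : CartierDivisor (A.fibre s).toAbelianVariety.X.left, HasRank (tensorObj
      ((Scheme.Modules.pullback ((A.fibre s).toAbelianVariety.translation P).left).obj (A.lineBundleOfDivisor s Θ₀))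
      (Modules.dual (A.lineBundleOfDivisor s Θ₀))) 1 := fun Θ₀ =>
    hasRank_tensorObj_one (hasRank_pullback _ (A.hasRank_lineBundleOfDivisor s _))
      (hasRank_dual (A.hasRank_lineBundleOfDivisor s _))
  refine (nonempty_iso_iff_detClass_eq (hr Θ) (hr Θ') (HasRank.isFiniteLocallyFree' (hr Θ))
    (HasRank.isFiniteLocallyFree' (hr Θ'))).2 ?_
  rw [A.detClass_translationPullback_tensor_dual s Θ P (HasRank.isFiniteLocallyFree' (hr Θ)),
    A.detClass_translationPullback_tensor_dual s Θ' P (HasRank.isFiniteLocallyFree' (hr Θ')), hΘ.cechClass_eq]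

/-- **`λ̄ = Λ(𝒪(Θ))` is insensitive to replacing `Θ` by the same divisor `Θ'`** (e.g. a re-bracketed iterated pull-back
`g'^*(g^*Θ) ∼ (g' ≫ g)^*Θ`, or `(𝟙)^*Θ ∼ Θ`): bookkeeping for consumers of the transport theorems.
[cite: MumfordFogartyKirwan1994, Ch. 6 §2 Definition 6.2–6.3 (p. 120)] -/
theorem IsLambdaOfAt.of_sameDivisor {Θ Θ' : CartierDivisor (A.fibre s).toAbelianVariety.X.left} (hΘ : Θ.SameDivisor Θ')
    (h : A.IsLambdaOfAt s D lam Θ) : A.IsLambdaOfAt s D lam Θ' := fun P =>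
  (h P).elim fun i => (A.nonempty_translationPullback_tensor_dual_iso_of_sameDivisor s hΘ P).map fun j => i ≪≫ j

/-- `IsLambdaOfAt` for the same divisor, as an `iff`. [cite: MumfordFogartyKirwan1994, Ch. 6 §2 Definition 6.2–6.3 (p. 120)] -/
theorem isLambdaOfAt_congr_sameDivisor {Θ Θ' : CartierDivisor (A.fibre s).toAbelianVariety.X.left}
    (hΘ : Θ.SameDivisor Θ') : A.IsLambdaOfAt s D lam Θ ↔ A.IsLambdaOfAt s D lam Θ' :=
  ⟨IsLambdaOfAt.of_sameDivisor A D lam s hΘ, IsLambdaOfAt.of_sameDivisor A D lam s hΘ.symm⟩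

/-- **`λ̄ = Λ(𝒪(Θ))` at `s` implies `λ̄ = Λ(𝒪((e⁻¹)^*(π_σ^*Θ)))` at `Spec σ ≫ s`** — §3 `along_specTwist` with the iterated
pull-back re-bracketed, so that the divisor is literally the tree's CONJUGATE DIVISOR `Θ^σ = π_σ^*Θ`
(★ `weilPairingLevel_conjugate`, same `(π, hπ)` typing) carried to `A_{Spec σ ≫ s}` along `e = conjFibreIso σ s`.
[cite: Milne2005ShimuraVarieties, §14 pp. 124–125 («σ(A, s, ηK) = (σA, σs, σηK)»)]
[cite: MumfordFogartyKirwan1994, Ch. 6 §2 Definition 6.2–6.3 (p. 120)] -/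
theorem IsLambdaOfAt.along_specTwist_pullback_pullback
    (π : ((A.fibre s).toAbelianVariety.conjugate σ).X.left ⟶ (A.fibre s).toAbelianVariety.X.left)
    (hπ : π = baseChangeHomFst σ.toRingHom (A.fibre s).toAbelianVariety.X) [IsDominant π]
    {Θ : CartierDivisor (A.fibre s).toAbelianVariety.X.left} (h : A.IsLambdaOfAt s D lam Θ) :
    haveI : IsDominant (AbelianVariety.Hom.toSchemeHom (A.conjFibreIso σ s).inv) :=
      AbelianVariety.isDominant_toSchemeHom_iso_hom (A.conjFibreIso σ s).symm
    A.IsLambdaOfAt (specTwist σ ≫ s) D lam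
      ((Θ.pullback π).pullback (AbelianVariety.Hom.toSchemeHom (A.conjFibreIso σ s).inv)) := by
  haveI : IsDominant (AbelianVariety.Hom.toSchemeHom (A.conjFibreIso σ s).inv) :=
    AbelianVariety.isDominant_toSchemeHom_iso_hom (A.conjFibreIso σ s).symm
  haveI : IsDominant (AbelianVariety.Hom.toSchemeHom (A.conjFibreIso σ s).inv ≫ π) := inferInstance
  exact IsLambdaOfAt.of_sameDivisor A D lam (specTwist σ ≫ s) (Θ.pullback_pullback_sameDivisor _ _).symm
    (IsLambdaOfAt.along_specTwist A D lam σ s (AbelianVariety.Hom.toSchemeHom (A.conjFibreIso σ s).inv ≫ π)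
      (by rw [hπ]) h)

end SameDivisor

/-! ### §E3 The point-equality step along `fibreCongrIso` -/

section FibreCongr

variable {s₁ s₂ : Spec (.of L) ⟶ S}

/-- On underlying schemes `fibreCongrIso rfl` is the identity. [cite: GortzWedhorn2020, Section (4.7) (p. 135)] -/
theorem toSchemeHom_fibreCongrIso_inv_rfl :
    AbelianVariety.Hom.toSchemeHom (A.fibreCongrIso (rfl : s₁ = s₁)).inv = 𝟙 _ := by
  have h1 : (A.fibreCongrIso (rfl : s₁ = s₁)).inv = 𝟙 _ := by
    simp [AbelianSchemeOver.fibreCongrIso]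
  rw [h1]
  rfl

/-- On underlying schemes `fibreCongrIso rfl` is the identity (forward direction). [cite: GortzWedhorn2020, Section (4.7) (p. 135)] -/
theorem toSchemeHom_fibreCongrIso_hom_rfl :
    AbelianVariety.Hom.toSchemeHom (A.fibreCongrIso (rfl : s₁ = s₁)).hom = 𝟙 _ := by
  have h1 : (A.fibreCongrIso (rfl : s₁ = s₁)).hom = 𝟙 _ := by
    simp [AbelianSchemeOver.fibreCongrIso]
  rw [h1]
  rfl

/-- **The point-equality step**: for `h : s₁ = s₂`, `λ̄ = Λ(𝒪(Θ))` at `s₁` implies `λ̄ = Λ(𝒪((c⁻¹)^*Θ))` at `s₂` along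
the transport `c = fibreCongrIso h : A_{s₁} ≅ A_{s₂}` (★ `PolarizedAbelianSchemeWithLevelBaseChange` §4; after `subst` the
map is `𝟙` and `(𝟙)^*Θ ∼ Θ`).  Lets §3 (point `Spec σ ≫ s`) feed ★ `IsLambdaOfAt.baseChange` (point `t ≫ g`) when the two
points agree only propositionally (`𝟙 ≫ Spec σ = Spec σ ≫ 𝟙`). [cite: MumfordFogartyKirwan1994, Ch. 6 §2 Definition 6.2–6.3 (p. 120)]
[cite: GortzWedhorn2020, Section (4.7) (p. 135)] -/
theorem IsLambdaOfAt.along_fibreCongrIso (h : s₁ = s₂) {Θ : CartierDivisor (A.fibre s₁).toAbelianVariety.X.left}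
    (hΘ : A.IsLambdaOfAt s₁ D lam Θ) :
    haveI : IsDominant (AbelianVariety.Hom.toSchemeHom (A.fibreCongrIso h).inv) :=
      AbelianVariety.isDominant_toSchemeHom_iso_hom (A.fibreCongrIso h).symm
    A.IsLambdaOfAt s₂ D lam (Θ.pullback (AbelianVariety.Hom.toSchemeHom (A.fibreCongrIso h).inv)) := by
  haveI : IsDominant (AbelianVariety.Hom.toSchemeHom (A.fibreCongrIso h).inv) :=
    AbelianVariety.isDominant_toSchemeHom_iso_hom (A.fibreCongrIso h).symm
  subst h
  exact IsLambdaOfAt.of_sameDivisor A D lam s₁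
    (((Θ.pullback_congr_sameDivisor (A.toSchemeHom_fibreCongrIso_inv_rfl (s₁ := s₁))).trans
      Θ.pullback_id_sameDivisor).symm) hΘ

/-- **The point-equality step, forward transport**: for `h : s₁ = s₂`, `λ̄ = Λ(𝒪(Θ))` at `s₂` implies
`λ̄ = Λ(𝒪(c^*Θ))` at `s₁`, `c = fibreCongrIso h`. [cite: MumfordFogartyKirwan1994, Ch. 6 §2 Definition 6.2–6.3 (p. 120)]
[cite: GortzWedhorn2020, Section (4.7) (p. 135)] -/
theorem IsLambdaOfAt.along_fibreCongrIso_symm (h : s₁ = s₂) {Θ : CartierDivisor (A.fibre s₂).toAbelianVariety.X.left}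
    (hΘ : A.IsLambdaOfAt s₂ D lam Θ) :
    haveI : IsDominant (AbelianVariety.Hom.toSchemeHom (A.fibreCongrIso h).hom) :=
      AbelianVariety.isDominant_toSchemeHom_iso_hom (A.fibreCongrIso h)
    A.IsLambdaOfAt s₁ D lam (Θ.pullback (AbelianVariety.Hom.toSchemeHom (A.fibreCongrIso h).hom)) := by
  haveI : IsDominant (AbelianVariety.Hom.toSchemeHom (A.fibreCongrIso h).hom) :=
    AbelianVariety.isDominant_toSchemeHom_iso_hom (A.fibreCongrIso h)
  subst h
  exact IsLambdaOfAt.of_sameDivisor A D lam s₁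
    (((Θ.pullback_congr_sameDivisor (A.toSchemeHom_fibreCongrIso_hom_rfl (s₁ := s₁))).trans
      Θ.pullback_id_sameDivisor).symm) hΘ

end FibreCongr

end AbelianSchemeOver

end Literature.AlgebraicGeometry.AbelianSchemes

end
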